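import Summits.ResolutionOfSingularities.ResolutionOfSingularities.Theorems.HilbertSamuelEliminationSigmaMaxModificationsCorridor3SigmaIsoBoundaryDefs
import HarnessLib

/-!
# [OURS · L1 W4.2] `Corridor3WLadderHybridLowDefs` — the two From-`s₀` strata rows of the STRATEGY-GENERIC LOW ADAPTER:
# (b)From «late births through the chain points settle» and (c-swallow)From «late blow-ups of the chain point swallow a stratum component
# through it», for an ARBITRARY boundary-reading strategy `σ : StrategyE` and an arbitrary start state `s₀`

Crux chain w42 (`SigmaMaxModifications`, stmt-ResolutionOfSingularities-18506; conjunct `SigmaMaxModificationsCorridor3`,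
stmt-ResolutionOfSingularities-19249), res-L1-w42-plan-1 RULINGS v3.14-21 (FS) «LOW ADAPTER := res-type-040, strategy-generic» and v3.14-22 (FW).
Typer res-type-040 (gen 19). DEFINITIONS ONLY (two `def … : Prop` rows, OPEN obligations-as-binders; nothing is claimed); the adapter's theorems
are `…Corridor3WLadderHybridLowTree` (tree lemma, unique dominating successor, (SD2-comp)) and `…Corridor3WLadderHybridLow` (the core
«(b)From ∧ (c-swallow)From ⇒ no moving never-isolated chain», the Low join). OURS (cell res-hironaka, slot W4.2); NOT statements of
H. Hironaka's manuscript [Hironaka2017] nor of [CossartJannsenSaito2020]; AI-typed, weaker than expert review. Helper vocabulary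
`--supports stmt-ResolutionOfSingularities-19249 --as helper` (counted 0).

WHY THESE TWO ROWS. For the CJS / Ω⁺ strategies, stub-4's row (c) «no infinite lineage through the chain points» follows from (c-geo) ∧ (c-rep) by a
LABEL argument (treated label eventually constant, late blow-ups are cycle ENDS, the END centre contains the label-`j` lineage — bricks 3b/4,
p529370/p530900). res-D-pv-047's E7 (`HybridEliminationHyp3`, p532289) runs the menu HYBRID `π.hybrid (ofStageOracleE ω)`, whose W-low chains
see menu steps (π decides per STATE): the label argument does not apply verbatim. The adapter replaces it by a TREE argument that needs exactly:
(b)From — from some stage on every stratum component through `x_{n+1}` dominates one through `x_n` (stub-4's (b), From-`s₀` form); and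
(c-swallow)From — from some stage on every allowed step that blows up `x_n` has a centre CONTAINING some stratum component through `x_n`. Then
brick 4E (every lineage is hit finitely often) + «off the centre a component has one dominating successor» + the tree lemma give: `x_n` is blown
up finitely often. For Ω⁺(E), (c-swallow) ⟸ (c-rep)σ⁺ (no late replay sub-hits) ∧ «END centres swallow the label-`j` component through `x_n`»
(brick 3b's lineage tracking); for the hybrid its residual is plan-1's (c-menu) «no late menu SUB-hits of `x_n`» (RULING (FW)). Both rows quantify
over chains `c` with `ReachesσE σ N ν s₀ (c 0)` (tails allowed), any grade `G`, never isolated, moving — the shape of the tree's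
`NoMovingNearChainFromσE` (res-L1-type-o1, p523041).

References: CJS LNM 2270 Rem. 6.29 (1), Thm. 3.14, Prop. 6.31, p. 105, p. 107 [CossartJannsenSaito2020]; tree `…WLadderStrataLineages`
(p500484: `StrataBirthsSettle`, `componentsThrough`), `…SigmaStrataLineages` (p526259: `StrataBirthsSettleσ`), `…SigmaBoundaryDefs` (p523041),
`…SigmaIsoBoundaryDefs` (p528217: `StepProjectionσE`).
-/

noncomputable section

set_option linter.dupNamespace false

open CategoryTheory AlgebraicGeometry TopologicalSpace Topology
open Summit.ResolutionOfSingularities.ResolutionOfSingularities.Theorems.CampaignW42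
open Literature.AlgebraicGeometry.Resolution Literature.RingTheory.HilbertSamuel
open Summit.ResolutionOfSingularities.ResolutionOfSingularities.Theorems.SigmaMaxModificationsCorridor3
open Summit.ResolutionOfSingularities.ResolutionOfSingularities.Theorems.SigmaMaxModificationsCorridor3.Moving

namespace Summit.ResolutionOfSingularities.ResolutionOfSingularities.Theorems.SigmaMaxModificationsCorridor3.Sigma

universe u

/-- [OURS · L1 W4.2] **ROW (b)From — BIRTHS THROUGH THE CHAIN POINTS SETTLE, from the state `s₀`, for the boundary-reading strategy `σ`**
(From-`s₀` σE-copy of stub-4's `StrataBirthsSettle` / brick 1's `StrataBirthsSettleσ`): along every moving, never-isolated `G`-chain of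
σE-steps whose start is σ-reached from `s₀`, from some stage on every irreducible component of `X_{n+1}(ν)` through `x_{n+1}` DOMINATES an
irreducible component of `X_n(ν)` under the step projection. OURS row, OPEN as a binder; NOT a statement of the manuscript. Intended discharge:
births lie over the centre; a component through `x_{n+1}` born at a late step is a fibre birth or a moving birth over a positive-dimensional
centre germ at `x_n` (res-type-067's birth dictionaries, CJS Thm. 3.14 locus form). [cite: CossartJannsenSaito2020, Rem. 6.29 (1), Thm. 3.14] -/
def StrataBirthsSettleFromσE (σ : StrategyE.{u}) (N : ℕ) (ν : ℕ → ℕ) (s₀ : MarkedStageE.{u}) (G : MarkedStage.{u} → Prop) : Prop :=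
  ∀ c : ℕ → MarkedStageE.{u}, ReachesσE σ N ν s₀ (c 0) → (∀ n, CanonicalNearStepσE σ N ν (c n) (c (n + 1))) →
    (∀ n, G (c n).toMarkedStage) → (∀ n, ¬ Iso N (c n).toMarkedStage) → (∀ n, ∃ m, n ≤ m ∧ (c m).IsBlownUpσE σ N ν) →
    ∃ n₁, ∀ n, n₁ ≤ n → ∀ f : (c (n + 1)).W ⟶ (c n).W, StepProjectionσE σ N ν (c n) (c (n + 1)) f →
      ∀ Z' ∈ componentsThrough N ν (c (n + 1)).toMarkedStage,
        closure (f.base '' Z') ∈ componentsIn (Scheme.hsStratum (c n).W N ν)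

/-- [OURS · L1 W4.2] **ROW (c-swallow)From — LATE BLOW-UPS OF THE CHAIN POINT SWALLOW A STRATUM COMPONENT THROUGH IT, from `s₀`, for `σ`**:
along every moving, never-isolated `G`-chain of σE-steps whose start is σ-reached from `s₀`, from some stage on, every step `σ` allows at the
state of `X_n` whose centre `V(C)` contains the chain point `x_n` has `V(C) ⊇ Z` for SOME irreducible component `Z ∋ x_n` of `X_n(ν)`. For the
Ω⁺(E) strategies this is (c-rep)σ⁺ «late blow-ups of `x_n` are cycle ends» together with «the END centre contains the label-`j` component
through `x_n`» (brick 3b's tracking); for res-L1-type-o1's menu hybrids its residual is plan-1's (c-menu) «no late menu SUB-hits of `x_n`: no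
late menu centre `C ∋ x_n` with `C ⊉` every `X(ν)`-component through `x_n`» (RULING v3.14-22 (FW)). OURS row, OPEN as a binder; NOT a statement
of the manuscript. [cite: CossartJannsenSaito2020, Rem. 6.29 (1), Prop. 6.31, p. 105] -/
def StrataSwallowFromσE (σ : StrategyE.{u}) (N : ℕ) (ν : ℕ → ℕ) (s₀ : MarkedStageE.{u}) (G : MarkedStage.{u} → Prop) : Prop :=
  ∀ c : ℕ → MarkedStageE.{u}, ReachesσE σ N ν s₀ (c 0) → (∀ n, CanonicalNearStepσE σ N ν (c n) (c (n + 1))) →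
    (∀ n, G (c n).toMarkedStage) → (∀ n, ¬ Iso N (c n).toMarkedStage) → (∀ n, ∃ m, n ≤ m ∧ (c m).IsBlownUpσE σ N ν) →
    ∃ n₁, ∀ n, n₁ ≤ n → ∀ (C : (c n).W.IdealSheafData) (P' : Option (Pending (blowup C))),
      σ.step (c n).W (c n).ln N ν (c n).L (c n).P (c n).E C P' → (c n).pt ∈ (C.support : Set (c n).W) →
        ∃ Z ∈ componentsThrough N ν (c n).toMarkedStage, Z ⊆ (C.support : Set (c n).W)

variable {σ : StrategyE.{u}} {N : ℕ} {ν : ℕ → ℕ} {s₀ s₁ : MarkedStageE.{u}} {G G' : MarkedStage.{u} → Prop}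

/-- (b)From is inherited by σ-reached states and by smaller grades. [folklore] -/
theorem StrataBirthsSettleFromσE.of_reaches_mono (h : StrataBirthsSettleFromσE σ N ν s₀ G) (hr : ReachesσE σ N ν s₀ s₁)
    (hG : ∀ s, G' s → G s) : StrataBirthsSettleFromσE σ N ν s₁ G' :=
  fun c h0 hstep hG' hnI hmov => h c (hr.trans h0) hstep (fun n => hG _ (hG' n)) hnI hmov

/-- (c-swallow)From is inherited by σ-reached states and by smaller grades. [folklore] -/
theorem StrataSwallowFromσE.of_reaches_mono (h : StrataSwallowFromσE σ N ν s₀ G) (hr : ReachesσE σ N ν s₀ s₁)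
    (hG : ∀ s, G' s → G s) : StrataSwallowFromσE σ N ν s₁ G' :=
  fun c h0 hstep hG' hnI hmov => h c (hr.trans h0) hstep (fun n => hG _ (hG' n)) hnI hmov

end Summit.ResolutionOfSingularities.ResolutionOfSingularities.Theorems.SigmaMaxModificationsCorridor3.Sigma

end
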